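import Literature.NumberTheory.GaloisRepresentations.GaloisCohomologyProofs
import Mathlib.FieldTheory.IsAlgClosed.Basic
import Mathlib.RingTheory.RootsOfUnity.Basic
import HarnessLib

/-!
# Kummer theory: lifting locally constant Galois `1`-cocycles along the power maps `μ_{M'} ↠ μ_M`

J.-P. Serre, *Local Fields* (1979), GTM 67, Ch. X §3 b) ("Kummer theory": for `n` invertible in `K`,
the exact sequence `1 → μ_n → K_s^* → K_s^* → 1` and `H¹(G, K_s^*) = 0` give
`H¹(G(K_s/K), μ_n) = K^*/K^{*n}`) [cite: Serre1979, Ch. X §3 b)]; the vanishing `H¹ = 0` used is Hilbert's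
Theorem 90 in the locally-constant-cocycle form ALREADY PROVED in the tree
(`Literature.NumberTheory.GaloisRepresentations.AlgEquiv.exists_smul_div_eq_of_isOpen`,
`GaloisCohomologyProofs.lean`; Serre Ch. X §1 Prop. 2 / §3).

PROOF-ONLY file (no definitions, no named facts). What is proved, for a normal extension `L/K` with `L`
algebraically closed (e.g. an algebraic closure) and its automorphism group `Aut_K(L)` with the Krull
topology:

* `AlgEquiv.isLocallyConstant_of_cocycle_of_isOpen_ker`: a multiplicative `1`-cocycle
  `f : Aut_K(L) → Lˣ` (`f(gh) = g(f h) · f g`) whose kernel `{f = 1}` is open is locally constant;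
* `AlgEquiv.exists_cocycle_pow_eq_of_isOpen` (**Kummer lifting along `x ↦ x^k`**): such an `f` is the
  `k`-th power (`k ≥ 1`) of a cocycle `f'` of the same kind — by Hilbert 90 `f(g) = g(x)/x`, and
  `f'(g) := g(y)/y` with `y^k = x` works, its kernel containing the open subgroup `Gal(L/K(y))`;
* `AlgEquiv.exists_rootsOfUnity_cocycle_lift`: the same for cocycles valued in the roots of unity:
  every `μ_M`-valued cocycle with open kernel is the image under `ζ ↦ ζ^{M'/M}` (`M ∣ M'`) of a
  `μ_{M'}`-valued locally constant cocycle with open kernel — i.e. the natural map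
  `H¹_cont(Aut_K(L), μ_{M'}) → H¹_cont(Aut_K(L), μ_M)` is onto already at the level of cocycles
  (Serre's `K^*/K^{*M'} ↠ K^*/K^{*M}`).

Consumer: the abc-iut cell, layer L2 ([EtTh] §2): the "Kummer lifting" hypothesis of the discharge of
[EtTh] Cor. 2.18 (iv) (reduction of automorphisms of mono-theta environments along `M ∣ M'`) and
Cor. 2.19 (ii) (`EtaleTheta/Discharge/Sec2ReductionProofs.lean`, `ThetaEnvTower.cor218_iv_reduction_of`)
for the model tower of the §1 theta setting. Nothing about [EtTh] is asserted here.
-/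

noncomputable section

open scoped Topology

namespace Literature.NumberTheory.GaloisRepresentations

universe u v

variable {K : Type u} {L : Type v} [Field K] [Field L] [Algebra K L]

/-- A multiplicative `1`-cocycle `f : Aut_K(L) → Lˣ`, `f(gh) = g(f h) · f(g)`, takes the value `1` at `1`.
[cite: Serre1979, Ch. X §3 b)] -/
theorem AlgEquiv.cocycle_map_one (f : (L ≃ₐ[K] L) → Lˣ) (hf : ∀ g h, f (g * h) = g • f h * f g) :
    f 1 = 1 := by
  simpa only [mul_one, one_smul, left_eq_mul] using hf 1 1

/-- A multiplicative `1`-cocycle `f : Aut_K(L) → Lˣ` is right-invariant under its kernel: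
`f(g u) = f(g)` whenever `f(u) = 1`. [cite: Serre1979, Ch. X §3 b)] -/
theorem AlgEquiv.cocycle_mul_of_map_eq_one (f : (L ≃ₐ[K] L) → Lˣ)
    (hf : ∀ g h, f (g * h) = g • f h * f g) {u : L ≃ₐ[K] L} (hu : f u = 1) (g : L ≃ₐ[K] L) :
    f (g * u) = f g := by
  rw [hf, hu, smul_one, one_mul]

/-- **A `1`-cocycle `Aut_K(L) → Lˣ` with open kernel is locally constant** (Krull topology on
`Aut_K(L)`, any topology on `Lˣ`): on the open set `g · {f = 1}` it is constant, by right-invariance under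
the kernel. This is the passage "continuous cochains with values in a discrete module are locally
constant" of Serre, Ch. X §3, read for `1`-cocycles. [cite: Serre1979, Ch. X §3 b)] -/
theorem AlgEquiv.isLocallyConstant_of_cocycle_of_isOpen_ker (f : (L ≃ₐ[K] L) → Lˣ)
    (hf : ∀ g h, f (g * h) = g • f h * f g) (hopen : IsOpen {g | f g = 1}) :
    IsLocallyConstant f := by
  refine (IsLocallyConstant.iff_exists_open f).2 fun g => ?_
  refine ⟨(fun u => g * u) '' {u | f u = 1}, (Homeomorph.mulLeft g).isOpenMap _ hopen,
    ⟨1, AlgEquiv.cocycle_map_one f hf, mul_one g⟩, ?_⟩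
  rintro _ ⟨u, hu, rfl⟩
  exact AlgEquiv.cocycle_mul_of_map_eq_one f hf hu g

/-- The stabiliser in `Aut_K(L)` of a unit `y ∈ Lˣ` is open for the Krull topology: it contains the
fixing subgroup `Gal(L/K(y))` of the finite extension `K(y)` (`L/K` algebraic).
[cite: Serre1979, Ch. X §3 b)] -/
theorem AlgEquiv.isOpen_setOf_smul_units_eq [Algebra.IsAlgebraic K L] (y : Lˣ) :
    IsOpen {g : L ≃ₐ[K] L | g • y = y} := by
  haveI : FiniteDimensional K (IntermediateField.adjoin K {(y : L)}) :=
    IntermediateField.adjoin.finiteDimensional (Algebra.IsIntegral.isIntegral (y : L))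
  have hle : (IntermediateField.adjoin K {(y : L)}).fixingSubgroup ≤
      MulAction.stabilizer (L ≃ₐ[K] L) y := by
    intro σ hσ
    rw [MulAction.mem_stabilizer_iff]
    rw [IntermediateField.mem_fixingSubgroup_iff] at hσ
    have hy : σ (y : L) = y := hσ _ (IntermediateField.mem_adjoin_simple_self K (y : L))
    exact Units.ext (by rw [AlgEquiv.smul_units_def, Units.coe_map, MonoidHom.coe_coe, hy])
  have hopen : IsOpen ((MulAction.stabilizer (L ≃ₐ[K] L) y : Subgroup (L ≃ₐ[K] L)) :
      Set (L ≃ₐ[K] L)) :=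
    Subgroup.isOpen_mono hle (IntermediateField.fixingSubgroup_isOpen _)
  convert hopen using 1
  ext g
  simp only [Set.mem_setOf_eq, SetLike.mem_coe, MulAction.mem_stabilizer_iff]

/-- **Kummer lifting along the `k`-th power map** (`k ≥ 1`), for a normal extension `L/K` with `L`
algebraically closed: a `1`-cocycle `f : Aut_K(L) → Lˣ` with open kernel is the `k`-th power of a
`1`-cocycle `f'` with open kernel. Proof (Serre, Ch. X §3 b), the surjection `K^* ↠ K^*/K^{*n}` composed
with Hilbert 90 `H¹(G, L^*) = 0`): `f(g) = g(x)/x` for some `x ∈ Lˣ`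
(`AlgEquiv.exists_smul_div_eq_of_isOpen`); pick `y ∈ L` with `y^k = x` (`L` algebraically closed) and put
`f'(g) := g(y)/y`; its kernel is the stabiliser of `y`, open. [cite: Serre1979, Ch. X §3 b)] -/
theorem AlgEquiv.exists_cocycle_pow_eq_of_isOpen [Normal K L] [IsAlgClosed L] (k : ℕ) (hk : 0 < k)
    (f : (L ≃ₐ[K] L) → Lˣ) (hf : ∀ g h, f (g * h) = g • f h * f g) (hopen : IsOpen {g | f g = 1}) :
    ∃ f' : (L ≃ₐ[K] L) → Lˣ, (∀ g h, f' (g * h) = g • f' h * f' g) ∧ IsOpen {g | f' g = 1} ∧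
      ∀ g, f' g ^ k = f g := by
  classical
  obtain ⟨x, hx⟩ := AlgEquiv.exists_smul_div_eq_of_isOpen f hf hopen
  obtain ⟨y, hy⟩ := IsAlgClosed.exists_pow_nat_eq (x : L) hk
  have hy0 : y ≠ 0 := by
    rintro rfl
    rw [zero_pow hk.ne'] at hy
    exact x.ne_zero hy.symm
  set y' : Lˣ := Units.mk0 y hy0 with hy'def
  have hy' : y' ^ k = x := Units.ext (by rw [Units.val_pow_eq_pow_val, Units.val_mk0, hy])
  refine ⟨fun g => g • y' / y', fun g h => ?_, ?_, fun g => ?_⟩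
  · -- the cocycle identity of a principal crossed homomorphism
    dsimp only
    rw [mul_smul, smul_div', div_mul_div_cancel]
  · -- the kernel is the stabiliser of `y`
    have : {g : L ≃ₐ[K] L | g • y' / y' = 1} = {g | g • y' = y'} := by
      ext g
      simp only [Set.mem_setOf_eq, div_eq_one]
    rw [this]
    exact AlgEquiv.isOpen_setOf_smul_units_eq y'
  · dsimp only
    rw [div_pow, ← smul_pow', hy', hx]

/-- **Kummer lifting for roots of unity**: for `M ∣ M'` (`M' ≥ 1`) and a normal extension `L/K` with
`L` algebraically closed, every `1`-cocycle `δ : Aut_K(L) → μ_M(L)` with open kernel is the image,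
under the power map `μ_{M'} → μ_M`, `ζ ↦ ζ^{M'/M}`, of a locally constant `1`-cocycle
`δ' : Aut_K(L) → μ_{M'}(L)` with open kernel. Equivalently: the reduction map on continuous cohomology
`H¹(Aut_K(L), μ_{M'}) → H¹(Aut_K(L), μ_M)` is onto, already on cocycles — Serre's identification
`H¹(G, μ_n) = K^*/K^{*n}` (Ch. X §3 b)) together with the surjection `K^*/K^{*M'} ↠ K^*/K^{*M}`.
The cocycle identities are stated on the underlying units (`Aut_K(L)` acting on `Lˣ` through its action
on `L`). [cite: Serre1979, Ch. X §3 b)] -/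
theorem AlgEquiv.exists_rootsOfUnity_cocycle_lift [Normal K L] [IsAlgClosed L] {M M' : ℕ}
    (hM' : 0 < M') (hMM' : M ∣ M') (δ : (L ≃ₐ[K] L) → rootsOfUnity M L)
    (hδ : ∀ g h, ((δ (g * h) : Lˣ)) = g • (δ h : Lˣ) * δ g) (hopen : IsOpen {g | δ g = 1}) :
    ∃ δ' : (L ≃ₐ[K] L) → rootsOfUnity M' L,
      (∀ g h, ((δ' (g * h) : Lˣ)) = g • (δ' h : Lˣ) * δ' g) ∧ IsOpen {g | δ' g = 1} ∧
      IsLocallyConstant δ' ∧ ∀ g, (δ' g : Lˣ) ^ (M' / M) = δ g := by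
  have hM : 0 < M := Nat.pos_of_dvd_of_pos hMM' hM'
  have hk : 0 < M' / M := Nat.div_pos (Nat.le_of_dvd hM' hMM') hM
  have hopen' : IsOpen {g | (δ g : Lˣ) = 1} := by
    have : {g | (δ g : Lˣ) = 1} = {g | δ g = 1} := by
      ext g; simp only [Set.mem_setOf_eq, OneMemClass.coe_eq_one]
    rw [this]; exact hopen
  obtain ⟨f', hf', hf'open, hf'pow⟩ :=
    AlgEquiv.exists_cocycle_pow_eq_of_isOpen (M' / M) hk (fun g => (δ g : Lˣ)) hδ hopen'
  have hmem : ∀ g, f' g ∈ rootsOfUnity M' L := by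
    intro g
    rw [mem_rootsOfUnity, ← Nat.div_mul_cancel hMM', pow_mul, hf'pow]
    exact (mem_rootsOfUnity M (δ g : Lˣ)).1 (δ g).2
  refine ⟨fun g => ⟨f' g, hmem g⟩, fun g h => hf' g h, ?_, ?_, fun g => hf'pow g⟩
  · have : {g | (⟨f' g, hmem g⟩ : rootsOfUnity M' L) = 1} = {g | f' g = 1} := by
      ext g; simp only [Set.mem_setOf_eq, ← OneMemClass.coe_eq_one]
    rw [this]; exact hf'open
  · refine IsLocallyConstant.desc (fun g => (⟨f' g, hmem g⟩ : rootsOfUnity M' L))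
      (fun ζ : rootsOfUnity M' L => (ζ : Lˣ)) ?_ Subtype.val_injective
    exact AlgEquiv.isLocallyConstant_of_cocycle_of_isOpen_ker f' hf' hf'open

end Literature.NumberTheory.GaloisRepresentations

end
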